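import Literature.NumberTheory.Transcendental.NesterenkoEliminationZeros
import Literature.NumberTheory.Transcendental.NesterenkoFormsOnHyperplanes
import Literature.NumberTheory.Transcendental.NesterenkoEvalBounds
import Literature.NumberTheory.Transcendental.NesterenkoEliminationProp47Proofs
import Literature.NumberTheory.Transcendental.NesterenkoEliminationCor412Proofs
import Mathlib.Analysis.SpecialFunctions.Pow.Real
import HarnessLib

/-!
# LNM 1752 Ch. 3 Proposition 4.13 (the zero of `I` closest to `ω̄`) from Proposition 4.4 — proofs only

Topic `Literature/NumberTheory/Transcendental`. Proofs only (no definitions, no named facts). Main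
result:

* `NesterenkoPhilippon2001_ch3_prop_4_13_of_prop_4_4` — the named fact
  `NesterenkoPhilippon2001_ch3_prop_4_13` of `NesterenkoEliminationFacts.lean` (Nesterenko's
  Proposition 4.13, Nesterenko–Philippon (eds.), LNM 1752, Ch. 3 §4, p. 41, `K = ℚ`, `ν = 1`: for
  a homogeneous unmixed ideal `I ⊂ ℚ[x₀, …, x_m]` with `dim I = r − 1 ≥ 0` and `ω̄ ∈ ℂ^{m+1} ∖ 0`
  there is a zero `β̄` of `I` with
  `deg I · log ‖ω̄ − β̄‖ ≤ (1/r) log |I(ω̄)| + (1/r) h(I) + 4 m³ deg I`) FOLLOWS from the named fact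
  `NesterenkoPhilippon2001_ch3_prop_4_4` (Proposition 4.4: `Ī(r)` is principal, generated by a
  product of irreducible associated forms of the associated primes). The discharge
  `…prop_4_13_holds` is then the one-liner `…_of_prop_4_4 …prop_4_4_holds` once Proposition 4.4
  (which encodes the dimension theory of `V(I)`) is proved; the trust base of Ch. 3 Theorem 5.1
  (`Literature.Barriers.Schanuel.NesterenkoModularScope…`) thereby loses the leaf Prop. 4.13.

## The proof (the book prints none — "See [Nes10, Proposition 1.5]" —; this one is ours)

Notation: `F = chowForm I r` (so `Ī(r) = (F)` by Prop. 4.4), `N = deg I ≥ 1` its degree in each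
group `uᵢ`, `V = V(I) ⊂ P^m(ℂ)`, `‖ω̄ − β̄‖` the projective distance ((20), p. 40), `|·|` the
maximum modulus of the coefficients (Def. 4.1), `S⁽ⁱ⁾` generic skew-symmetric matrices (Def. 4.6).

1. *One block* (`one_block`). Let `g ∈ ℂ[x₀, …, x_m]`, `g ≠ 0`, be a form whose zeros are
   described by a set `V'` of non-zero vectors, `g(u) = 0 ↔ ∃ β̄ ∈ V', β̄ · u = 0`. By
   `exists_eq_C_mul_prod_linC` (`NesterenkoFormsOnHyperplanes.lean`), `g = c ∏_{i<N} ℓ_{β̄ᵢ}`,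
   `β̄ᵢ ∈ V'`. Substituting `S ω̄` for `x̲` turns `ℓ_β̄` into `∑_{a<b} s_{ab} (β_a ω_b − β_b ω_a)`,
   whose largest coefficient is `‖ω̄ − β̄‖ |ω̄| |β̄|` (`coeff_single_aeval_lam_linC`). Hence if
   `g(S ω̄) = 0` some `β̄ᵢ` has `‖ω̄ − β̄ᵢ‖ = 0`, and otherwise, for the `β̄ᵢ` closest to `ω̄`,
   `(‖ω̄ − β̄‖ |ω̄|)^N |g| ≤ e^{nN} (m+1)^N |g(S ω̄)|`, `n = m(m+1)/2` (Gelfond's inequality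
   `sum_log_maxNorm_le` for the product of the `N` linear forms in the `n` skew variables, and
   `‖ℓ_β̄‖₁ ≤ (m+1)|β̄|`).
2. *Block step* (`block_step`). In `T = ℂ[s⁽¹⁾, …, s⁽ʳ⁾, u₁, …, u_r]` let `F_k = Φ_k(F)` be `F`
   with the first `k` groups specialised, `uᵢ ↦ S⁽ⁱ⁾ω̄`; `|F_0| = |F|`, `|F_r| = |ϰ(F)|`. Pick a
   point `v₀` of the unit torus with `|F_k(v₀)| ≥ |F_k|` (`exists_eval_ge_maxNorm`,
   `NesterenkoEvalBounds.lean`); freezing all groups but the `k`-th at `v₀` turns `F` into a form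
   `g` of degree `N` in `u_k` with `|F_k| ≤ (m+1)^N |g|`, whose zeros are, by the zeros theorem
   `aeval_chowForm_eq_zero_iff` (`NesterenkoEliminationZeros.lean`), given by the set `V'` of
   zeros of `I` on the frozen hyperplanes; and `g(S ω̄)` is the specialisation of `F_{k+1}` at
   `v₀`, so `|g(S ω̄)| ≤ #supp F_{k+1} |F_{k+1}| ≤ (#vars T)^{rN} |F_{k+1}|`. With step 1:
   a zero `β̄` of `I` with `‖ω̄ − β̄‖ = 0` or
   `(‖ω̄ − β̄‖ |ω̄|)^N |F_k| ≤ C^N |F_{k+1}|`, `C = (m+1)² eⁿ (#vars T)^r ≤ e^{4m³}`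
   (`blockConst_le_exp`).
3. *Assembly.* If all `F_k ≠ 0`, the pigeonhole `exists_succ_le_rpow_mul` gives `k` with
   `|F_{k+1}| ≤ (|F_r|/|F_0|)^{1/r} |F_k| = |I(ω̄)|^{1/r} |ω̄|^N |F_k|` (Def. 4.6), whence
   `‖ω̄ − β̄‖^N ≤ e^{4m³N} |I(ω̄)|^{1/r} ≤ e^{4m³N} (|I(ω̄)| e^{h(I)})^{1/r}` (`h(I) ≥ 0`). If some
   `F_k = 0`, take `k` with `F_k ≠ 0 = F_{k+1}`: then `‖ω̄ − β̄‖ = 0` for a zero of `I`.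

## References

* [NesterenkoPhilippon2001] Yu. V. Nesterenko, P. Philippon (eds.), *Introduction to Algebraic
  Independence Theory*, LNM 1752, Springer 2001, Ch. 3 §4: Def. 4.1–4.6 (pp. 37–39), Prop. 4.4
  (p. 38), (20) (p. 40), Prop. 4.13 (p. 41); PDF page = book page + 12.
* [Nes10] Yu. V. Nesterenko, Proc. Steklov Inst. Math. 218 (1997) 294–331, Prop. 1.5 (the proof
  referred to in print; not consulted here).
* [BombieriGubler2006] E. Bombieri, W. Gubler, *Heights in Diophantine Geometry*, Lemma 1.6.11
  (Gelfond's inequality).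
-/

noncomputable section

open MvPolynomial Finset Real

namespace Literature.NumberTheory.Transcendental

namespace Nesterenko

variable {m : ℕ}


/-! ### The linear forms `ℓ_β̄(S ω̄)` in the skew variables -/

/-- Coefficient bookkeeping: the coefficient of the skew variable `s_{ab}` (`p = (a, b)`, `a < b`)
in the entry `S_{jl}` of the generic skew-symmetric matrix. [folklore] -/
theorem coeff_single_skewEntry (p : SkewIdx m) (j l : Fin (m + 1)) :
    coeff (Finsupp.single ((0 : Fin 1), p) 1) (skewEntry (0 : Fin 1) j l : RS 1 m) =
      if j = p.1.1 ∧ l = p.1.2 then 1 else if l = p.1.1 ∧ j = p.1.2 then -1 else 0 := by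
  classical
  have hp : p.1.1 < p.1.2 := p.2
  have key : ∀ (a b : Fin (m + 1)) (hab : a < b),
      coeff (Finsupp.single ((0 : Fin 1), p) 1)
        (X ((0 : Fin 1), (⟨(a, b), hab⟩ : SkewIdx m)) : RS 1 m) =
        if a = p.1.1 ∧ b = p.1.2 then 1 else 0 := by
    intro a b hab
    rw [coeff_X]
    by_cases h : a = p.1.1 ∧ b = p.1.2
    · rw [if_pos h, if_pos]
      obtain ⟨ha, hb⟩ := h
      subst ha; subst hb
      rfl
    · rw [if_neg h, if_neg]
      intro h'
      apply h
      have h'' := (Finsupp.single_left_inj (one_ne_zero)).mp h'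
      have := congrArg (fun q : Fin 1 × SkewIdx m => q.2.1) h''
      exact ⟨congrArg Prod.fst this, congrArg Prod.snd this⟩
  unfold skewEntry
  by_cases h1 : j < l
  · rw [dif_pos h1, key j l h1]
    by_cases hA : j = p.1.1 ∧ l = p.1.2
    · rw [if_pos hA, if_pos hA]
    · rw [if_neg hA, if_neg hA, if_neg]
      rintro ⟨hl, hj⟩
      rw [hl, hj] at h1
      exact lt_asymm h1 hp
  · rw [dif_neg h1]
    by_cases h2 : l < j
    · rw [dif_pos h2, coeff_neg, key l j h2]
      have hA : ¬ (j = p.1.1 ∧ l = p.1.2) := by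
        rintro ⟨hj, hl⟩
        rw [hj, hl] at h1
        exact h1 hp
      rw [if_neg hA]
      by_cases hB : l = p.1.1 ∧ j = p.1.2
      · rw [if_pos hB, if_pos hB]
      · rw [if_neg hB, if_neg hB, neg_zero]
    · rw [dif_neg h2, coeff_zero]
      have hjl : j = l := le_antisymm (not_lt.mp h2) (not_lt.mp h1)
      subst hjl
      rw [if_neg, if_neg]
      · rintro ⟨ha, hb⟩
        rw [ha] at hb
        exact (ne_of_lt hp) hb
      · rintro ⟨ha, hb⟩
        rw [ha] at hb
        exact (ne_of_lt hp) hb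

/-- **The coefficients of `ℓ_β̄(S ω̄)`**: substituting `(S ω̄)_j = ∑_l s_{jl} ω_l` for `x_j` in
`ℓ_β̄ = ∑_j β_j x_j` gives `∑_{a<b} s_{ab} (β_a ω_b − β_b ω_a)`.
[cite: NesterenkoPhilippon2001, Ch. 3 Def. 4.6 (p. 39)] -/
theorem coeff_single_aeval_lam_linC (ω β : Fin (m + 1) → ℂ) (p : SkewIdx m) :
    coeff (Finsupp.single ((0 : Fin 1), p) 1)
      (aeval (fun j => lam ω (0 : Fin 1) j) (∑ j, C (β j) * X j : MvPolynomial (Fin (m + 1)) ℂ)) =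
      β p.1.1 * ω p.1.2 - β p.1.2 * ω p.1.1 := by
  classical
  have hp : p.1.1 < p.1.2 := p.2
  have hne : p.1.1 ≠ p.1.2 := ne_of_lt hp
  simp only [map_sum, map_mul, aeval_C, aeval_X, lam, MvPolynomial.algebraMap_eq, coeff_sum,
    Finset.mul_sum]
  have e : ∀ j l : Fin (m + 1), coeff (Finsupp.single ((0 : Fin 1), p) 1)
      (C (β j) * (skewEntry (0 : Fin 1) j l * C (ω l)) : RS 1 m) =
      β j * ω l * (if j = p.1.1 ∧ l = p.1.2 then 1 else if l = p.1.1 ∧ j = p.1.2 then -1 else 0) := by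
    intro j l
    rw [mul_comm (skewEntry _ _ _) _, ← mul_assoc, ← map_mul, coeff_C_mul, coeff_single_skewEntry]
  simp_rw [e]
  -- the summand as a difference of two "delta" terms
  have e2 : ∀ j l : Fin (m + 1),
      β j * ω l * (if j = p.1.1 ∧ l = p.1.2 then (1 : ℂ) else if l = p.1.1 ∧ j = p.1.2 then -1 else 0)
        = (if j = p.1.1 then (if l = p.1.2 then β j * ω l else 0) else 0) -
          (if j = p.1.2 then (if l = p.1.1 then β j * ω l else 0) else 0) := by
    intro j l
    by_cases ha : j = p.1.1
    · have hb : j ≠ p.1.2 := by rw [ha]; exact hne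
      by_cases hc : l = p.1.2
      · simp [ha, hc, hne]
      · simp [ha, hc, hne]
    · by_cases hb : j = p.1.2
      · by_cases hc : l = p.1.1
        · simp [hb, hc, hne.symm]
        · simp [hb, hc, hne.symm]
      · simp [ha, hb]
  simp_rw [e2]
  simp_rw [Finset.sum_sub_distrib]
  have s1 : ∑ x : Fin (m + 1), ∑ y : Fin (m + 1),
      (if x = p.1.1 then (if y = p.1.2 then β x * ω y else 0) else 0) = β p.1.1 * ω p.1.2 := by
    rw [Finset.sum_eq_single p.1.1 (fun x _ hx => by simp [hx])
      (fun h => absurd (Finset.mem_univ _) h)]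
    simp
  have s2 : ∑ x : Fin (m + 1), ∑ y : Fin (m + 1),
      (if x = p.1.2 then (if y = p.1.1 then β x * ω y else 0) else 0) = β p.1.2 * ω p.1.1 := by
    rw [Finset.sum_eq_single p.1.2 (fun x _ hx => by simp [hx])
      (fun h => absurd (Finset.mem_univ _) h)]
    simp
  rw [s1, s2]

/-- Hence **`‖ω̄ − β̄‖ · |ω̄| · |β̄| ≤ |ℓ_β̄(S ω̄)|`** (each minor `ω_a β_b − ω_b β_a` is, up to sign,
a coefficient). [cite: NesterenkoPhilippon2001, Ch. 3 §4 (20) (p. 40)] -/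
theorem projDist_mul_le_maxNorm_aeval_lam_linC (ω β : Fin (m + 1) → ℂ) :
    projDist ω β * (‖ω‖ * ‖β‖) ≤
      maxNorm (aeval (fun j => lam ω (0 : Fin 1) j)
        (∑ j, C (β j) * X j : MvPolynomial (Fin (m + 1)) ℂ)) := by
  set L := aeval (fun j => lam ω (0 : Fin 1) j) (∑ j, C (β j) * X j : MvPolynomial (Fin (m + 1)) ℂ)
    with hL
  have hsup : ((Finset.univ.sup fun p : SkewIdx m =>
      ‖ω p.1.1 * β p.1.2 - ω p.1.2 * β p.1.1‖₊ : NNReal) : ℝ) ≤ maxNorm L := by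
    have h : (Finset.univ.sup fun p : SkewIdx m => ‖ω p.1.1 * β p.1.2 - ω p.1.2 * β p.1.1‖₊) ≤
        (maxNorm L).toNNReal := by
      refine Finset.sup_le fun p _ => ?_
      rw [Real.le_toNNReal_iff_coe_le (maxNorm_nonneg L), coe_nnnorm]
      have := norm_coeff_le_maxNorm L (Finsupp.single ((0 : Fin 1), p) 1)
      rw [hL, coeff_single_aeval_lam_linC] at this
      calc ‖ω p.1.1 * β p.1.2 - ω p.1.2 * β p.1.1‖
          = ‖β p.1.1 * ω p.1.2 - β p.1.2 * ω p.1.1‖ := by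
            rw [← norm_neg]; congr 1; ring
        _ ≤ maxNorm L := this
    have h' := NNReal.coe_le_coe.mpr h
    rwa [Real.coe_toNNReal _ (maxNorm_nonneg L)] at h'
  by_cases h0 : ‖ω‖ * ‖β‖ = 0
  · rw [h0, mul_zero]; exact maxNorm_nonneg _
  · rw [projDist, div_mul_cancel₀ _ h0]
    exact hsup

/-- `ℓ_β̄(S ω̄)` is a linear form in the skew variables: all its partial degrees are `≤ 1`.
[folklore] -/
theorem degreeOf_aeval_lam_linC_le (ω β : Fin (m + 1) → ℂ) (v : Fin 1 × SkewIdx m) :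
    degreeOf v (aeval (fun j => lam ω (0 : Fin 1) j)
      (∑ j, C (β j) * X j : MvPolynomial (Fin (m + 1)) ℂ)) ≤ 1 := by
  have hhom : (aeval (fun j => lam ω (0 : Fin 1) j)
      (∑ j, C (β j) * X j : MvPolynomial (Fin (m + 1)) ℂ)).IsHomogeneous 1 := by
    simp only [map_sum, map_mul, aeval_C, aeval_X, MvPolynomial.algebraMap_eq]
    refine IsHomogeneous.sum _ _ _ fun j _ => IsHomogeneous.C_mul ?_ _
    unfold lam
    refine IsHomogeneous.sum _ _ _ fun l _ => ?_
    have h1 : (skewEntry (0 : Fin 1) j l : RS 1 m).IsHomogeneous 1 := by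
      unfold skewEntry
      split_ifs
      · exact isHomogeneous_X _ _
      · exact (isHomogeneous_X _ _).neg
      · exact isHomogeneous_zero _ _ _
    simpa using h1.mul (isHomogeneous_C _ (ω l))
  exact (degreeOf_le_totalDegree _ _).trans hhom.totalDegree_le

/-- `‖ℓ_β̄‖₁ ≤ (m+1) |β̄|`. [folklore] -/
theorem l1Norm_linC_le (β : Fin (m + 1) → ℂ) :
    l1Norm (∑ j, C (β j) * X j : MvPolynomial (Fin (m + 1)) ℂ) ≤ (m + 1) * ‖β‖ := by
  calc l1Norm (∑ j, C (β j) * X j : MvPolynomial (Fin (m + 1)) ℂ)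
      ≤ ∑ j, l1Norm (C (β j) * X j : MvPolynomial (Fin (m + 1)) ℂ) := l1Norm_sum_le _ _
    _ ≤ ∑ _j : Fin (m + 1), ‖β‖ := Finset.sum_le_sum fun j _ => by
        calc l1Norm (C (β j) * X j : MvPolynomial (Fin (m + 1)) ℂ)
            ≤ l1Norm (C (β j) : MvPolynomial (Fin (m + 1)) ℂ) * l1Norm (X j : MvPolynomial _ ℂ) :=
              l1Norm_mul_le _ _
          _ = ‖β j‖ := by rw [l1Norm_C, l1Norm_X, mul_one]
          _ ≤ ‖β‖ := norm_le_pi_norm β j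
    _ = (m + 1) * ‖β‖ := by
        rw [Finset.sum_const, Finset.card_univ, Fintype.card_fin, nsmul_eq_mul, Nat.cast_add,
          Nat.cast_one]

/-- Gelfond's inequality in multiplicative form: `∏ |f_i| ≤ e^{∑_v ∑_i deg_v f_i} |∏ f_i|` for
non-zero complex polynomials. [cite: BombieriGubler2006, §1.6, Lemma 1.6.11 (p. 27)] -/
theorem prod_maxNorm_le_exp_mul_maxNorm_prod {σ ι : Type*} [Fintype σ] [DecidableEq σ]
    (s : Finset ι) (f : ι → MvPolynomial σ ℂ) (hf : ∀ i ∈ s, f i ≠ 0) :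
    ∏ i ∈ s, maxNorm (f i) ≤
      Real.exp (∑ v, (∑ i ∈ s, degreeOf v (f i) : ℝ)) * maxNorm (∏ i ∈ s, f i) := by
  have h := sum_log_maxNorm_le s f hf
  have hpos : ∀ i ∈ s, 0 < maxNorm (f i) := fun i hi => maxNorm_pos (hf i hi)
  have hprod0 : ∏ i ∈ s, f i ≠ 0 := Finset.prod_ne_zero_iff.mpr hf
  have hP : 0 < maxNorm (∏ i ∈ s, f i) := maxNorm_pos hprod0
  have e1 : ∏ i ∈ s, maxNorm (f i) = Real.exp (∑ i ∈ s, Real.log (maxNorm (f i))) := by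
    rw [Real.exp_sum]
    exact Finset.prod_congr rfl fun i hi => (Real.exp_log (hpos i hi)).symm
  rw [e1, ← Real.exp_log hP, ← Real.exp_add]
  refine Real.exp_le_exp.mpr ?_
  linarith

/-! ### The one-block estimate -/

/-- **One block of skew variables.** Let `g ∈ ℂ[x₀, …, x_m]`, `g ≠ 0`, `deg g ≥ 1`, have its zeros
described by a set `V'` of non-zero vectors (`g(u) = 0 ↔ ∃ β̄ ∈ V', β̄ · u = 0`), and let `ω̄ ≠ 0`.
Write `g(S ω̄)` for the substitution of `(S ω̄)_j = ∑_l s_{jl} ω_l` for `x_j` (one block of `ϰ`).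
Then: if `g(S ω̄) = 0`, some `β̄ ∈ V'` has `‖ω̄ − β̄‖ = 0`; and if `g(S ω̄) ≠ 0`, some `β̄ ∈ V'`
has `(‖ω̄ − β̄‖ |ω̄|)^{deg g} |g| ≤ e^{n deg g} (m+1)^{deg g} |g(S ω̄)|`, `n = #{(j,l) : j < l}`.
[cite: NesterenkoPhilippon2001, Ch. 3 Prop. 4.13 (p. 41)] -/
theorem one_block {g : MvPolynomial (Fin (m + 1)) ℂ} (hg : g ≠ 0) (hN : 0 < g.totalDegree)
    {V' : Set (Fin (m + 1) → ℂ)} (hV0 : ∀ β ∈ V', β ≠ 0)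
    (hiff : ∀ u : Fin (m + 1) → ℂ, eval u g = 0 ↔ ∃ β ∈ V', ∑ j, β j * u j = 0)
    {ω : Fin (m + 1) → ℂ} (hω : ω ≠ 0) :
    (aeval (fun j => lam ω (0 : Fin 1) j) g = 0 → ∃ β ∈ V', projDist ω β = 0) ∧
    (aeval (fun j => lam ω (0 : Fin 1) j) g ≠ 0 → ∃ β ∈ V',
      (projDist ω β * ‖ω‖) ^ g.totalDegree * maxNorm g ≤
        Real.exp (Fintype.card (Fin 1 × SkewIdx m) * g.totalDegree) *
          (m + 1 : ℝ) ^ g.totalDegree * maxNorm (aeval (fun j => lam ω (0 : Fin 1) j) g)) := by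
  classical
  set N := g.totalDegree with hNdef
  -- factorisation `g = c ∏ ℓ_{β i}`
  obtain ⟨c, hc, β, hβV, hgeq⟩ := exists_eq_C_mul_prod_linC hg hV0
    (fun β hβ u hu => (hiff u).mpr ⟨β, hβ, hu⟩) (fun u hu => (hiff u).mp hu)
  set κ : MvPolynomial (Fin (m + 1)) ℂ →ₐ[ℂ] RS 1 m := aeval (fun j => lam ω (0 : Fin 1) j)
    with hκdef
  set L : Fin N → RS 1 m := fun i => κ (∑ j, C (β i j) * X j) with hLdef
  have hκg : κ g = C c * ∏ i, L i := by
    rw [hgeq, map_mul, map_prod, hκdef, aeval_C, MvPolynomial.algebraMap_eq]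
  have hβ0 : ∀ i, β i ≠ 0 := fun i => hV0 _ (hβV i)
  have hωpos : 0 < ‖ω‖ := norm_pos_iff.mpr hω
  have hLge : ∀ i, projDist ω (β i) * (‖ω‖ * ‖β i‖) ≤ maxNorm (L i) := fun i =>
    projDist_mul_le_maxNorm_aeval_lam_linC ω (β i)
  refine ⟨fun h0 => ?_, fun h0 => ?_⟩
  · -- `κ g = 0`: some factor `L i` vanishes, hence `‖ω − β i‖ = 0`
    rw [hκg, mul_eq_zero, C_eq_zero] at h0
    obtain ⟨i, -, hi⟩ := Finset.prod_eq_zero_iff.mp (h0.resolve_left hc)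
    refine ⟨β i, hβV i, le_antisymm ?_ (projDist_nonneg _ _)⟩
    have h1 := hLge i
    rw [show L i = 0 from hi, maxNorm_zero] at h1
    have hpos : 0 < ‖ω‖ * ‖β i‖ := mul_pos hωpos (norm_pos_iff.mpr (hβ0 i))
    nlinarith [projDist_nonneg ω (β i)]
  · -- `κ g ≠ 0`: all factors are non-zero; take the `β i` closest to `ω`
    have hL0 : ∀ i, L i ≠ 0 := by
      intro i hi
      apply h0
      rw [hκg]
      exact mul_eq_zero_of_right _ (Finset.prod_eq_zero (Finset.mem_univ i) hi)
    have hne : (Finset.univ : Finset (Fin N)).Nonempty := ⟨⟨0, hN⟩, Finset.mem_univ _⟩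
    obtain ⟨i₀, -, hi₀⟩ := Finset.exists_min_image Finset.univ (fun i => projDist ω (β i)) hne
    set δ := projDist ω (β i₀) with hδ
    have hδ0 : 0 ≤ δ := projDist_nonneg _ _
    refine ⟨β i₀, hβV i₀, ?_⟩
    -- Gelfond: `∏ |L i| ≤ e^{nN} |∏ L i|`
    have hgelf := prod_maxNorm_le_exp_mul_maxNorm_prod Finset.univ L (fun i _ => hL0 i)
    have hdeg : (∑ v : Fin 1 × SkewIdx m, (∑ i, degreeOf v (L i) : ℝ)) ≤
        Fintype.card (Fin 1 × SkewIdx m) * N := by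
      calc (∑ v : Fin 1 × SkewIdx m, (∑ i, degreeOf v (L i) : ℝ))
          ≤ ∑ _v : Fin 1 × SkewIdx m, (N : ℝ) := Finset.sum_le_sum fun v _ => by
            calc (∑ i, degreeOf v (L i) : ℝ) ≤ ∑ _i : Fin N, (1 : ℝ) :=
                  Finset.sum_le_sum fun i _ => by
                    exact_mod_cast degreeOf_aeval_lam_linC_le ω (β i) v
              _ = N := by simp
        _ = Fintype.card (Fin 1 × SkewIdx m) * N := by
            rw [Finset.sum_const, Finset.card_univ, nsmul_eq_mul]
    have hgelf' : ∏ i, maxNorm (L i) ≤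
        Real.exp (Fintype.card (Fin 1 × SkewIdx m) * N) * maxNorm (∏ i, L i) :=
      hgelf.trans (mul_le_mul_of_nonneg_right (Real.exp_le_exp.mpr hdeg) (maxNorm_nonneg _))
    -- lower bound `∏ (δ |ω| |β i|) ≤ ∏ |L i|`
    have hlow : ∏ i, (δ * ‖ω‖ * ‖β i‖) ≤ ∏ i, maxNorm (L i) := by
      refine Finset.prod_le_prod (fun i _ => by positivity) fun i _ => ?_
      calc δ * ‖ω‖ * ‖β i‖ ≤ projDist ω (β i) * ‖ω‖ * ‖β i‖ := by
            gcongr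
            exact hi₀ i (Finset.mem_univ i)
        _ = projDist ω (β i) * (‖ω‖ * ‖β i‖) := by ring
        _ ≤ maxNorm (L i) := hLge i
    have hprodβ : ∏ i, (δ * ‖ω‖ * ‖β i‖) = (δ * ‖ω‖) ^ N * ∏ i, ‖β i‖ := by
      rw [Finset.prod_mul_distrib, Finset.prod_const, Finset.card_univ, Fintype.card_fin]
    -- upper bound `|g| ≤ |c| (m+1)^N ∏ |β i|`
    have hup : maxNorm g ≤ ‖c‖ * ((m + 1 : ℝ) ^ N * ∏ i, ‖β i‖) := by
      calc maxNorm g ≤ l1Norm g := maxNorm_le_l1Norm g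
        _ = l1Norm (C c * ∏ i, (∑ j, C (β i j) * X j : MvPolynomial (Fin (m + 1)) ℂ)) :=
            congrArg l1Norm hgeq
        _ ≤ l1Norm (C c : MvPolynomial (Fin (m + 1)) ℂ) *
              l1Norm (∏ i, (∑ j, C (β i j) * X j : MvPolynomial (Fin (m + 1)) ℂ)) :=
            l1Norm_mul_le _ _
        _ ≤ ‖c‖ * ∏ i, ((m + 1 : ℝ) * ‖β i‖) := by
            rw [l1Norm_C]
            refine mul_le_mul_of_nonneg_left ?_ (norm_nonneg _)
            refine (l1Norm_prod_le _ _).trans ?_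
            exact Finset.prod_le_prod (fun i _ => l1Norm_nonneg _) fun i _ => l1Norm_linC_le (β i)
        _ = ‖c‖ * ((m + 1 : ℝ) ^ N * ∏ i, ‖β i‖) := by
            rw [Finset.prod_mul_distrib, Finset.prod_const, Finset.card_univ, Fintype.card_fin]
    -- `|κ g| = |c| |∏ L i|`
    have hκnorm : maxNorm (κ g) = ‖c‖ * maxNorm (∏ i, L i) := by
      rw [hκg, maxNorm_C_mul]
    -- assemble
    have hP0 : 0 ≤ ∏ i, ‖β i‖ := Finset.prod_nonneg fun i _ => norm_nonneg _
    have hkey : (δ * ‖ω‖) ^ N * ∏ i, ‖β i‖ ≤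
        Real.exp (Fintype.card (Fin 1 × SkewIdx m) * N) * maxNorm (∏ i, L i) := by
      rw [← hprodβ]; exact hlow.trans hgelf'
    calc (δ * ‖ω‖) ^ N * maxNorm g
        ≤ (δ * ‖ω‖) ^ N * (‖c‖ * ((m + 1 : ℝ) ^ N * ∏ i, ‖β i‖)) :=
          mul_le_mul_of_nonneg_left hup (by positivity)
      _ = ‖c‖ * (m + 1 : ℝ) ^ N * ((δ * ‖ω‖) ^ N * ∏ i, ‖β i‖) := by ring
      _ ≤ ‖c‖ * (m + 1 : ℝ) ^ N *
            (Real.exp (Fintype.card (Fin 1 × SkewIdx m) * N) * maxNorm (∏ i, L i)) :=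
          mul_le_mul_of_nonneg_left hkey (by positivity)
      _ = Real.exp (Fintype.card (Fin 1 × SkewIdx m) * N) * (m + 1 : ℝ) ^ N * maxNorm (κ g) := by
          rw [hκnorm]; ring



/-! ### Generalities -/

/-- **Pigeonhole over the blocks**: for positive `a₀, …, a_r` some ratio `a_{k+1}/a_k` is at most
the geometric mean `(a_r/a_0)^{1/r}`. [folklore] -/
theorem exists_succ_le_rpow_mul {r : ℕ} (hr : 0 < r) (a : ℕ → ℝ) (ha : ∀ k ≤ r, 0 < a k) :
    ∃ k < r, a (k + 1) ≤ (a r / a 0) ^ (1 / (r : ℝ)) * a k := by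
  set t := (a r / a 0) ^ (1 / (r : ℝ)) with ht
  have ht0 : 0 ≤ t := Real.rpow_nonneg (div_nonneg (ha r le_rfl).le (ha 0 (Nat.zero_le _)).le) _
  by_contra hcon
  push Not at hcon
  -- then `t^k a 0 < a k` for `1 ≤ k ≤ r`
  have hlt : ∀ k, 1 ≤ k → k ≤ r → t ^ k * a 0 < a k := by
    intro k hk1 hkr
    induction k with
    | zero => omega
    | succ k ih =>
      rcases Nat.eq_zero_or_pos k with rfl | hkpos
      · simpa using hcon 0 hr
      · have h1 := ih hkpos (by omega)
        have h2 := hcon k (by omega)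
        calc t ^ (k + 1) * a 0 = t * (t ^ k * a 0) := by ring
          _ ≤ t * a k := mul_le_mul_of_nonneg_left h1.le ht0
          _ < a (k + 1) := h2
  have h := hlt r hr le_rfl
  have htr : t ^ r = a r / a 0 := by
    rw [ht, one_div]
    exact Real.rpow_inv_natCast_pow (div_nonneg (ha r le_rfl).le (ha 0 (Nat.zero_le _)).le) hr.ne'
  rw [htr, div_mul_cancel₀ _ (ha 0 (Nat.zero_le _)).ne'] at h
  exact lt_irrefl _ h

/-- Substituting forms of degree `w(v)` for the variables `v` of a polynomial that is
weighted-homogeneous of weight `n` for `w` gives a form of degree `n`. [folklore] -/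
theorem isHomogeneous_aeval_of_isWeightedHomogeneous {σ τ : Type*} {w : σ → ℕ}
    {P : MvPolynomial σ ℚ} {n : ℕ} (hP : IsWeightedHomogeneous w P n)
    (ψ : σ → MvPolynomial τ ℂ) (hψ : ∀ v, (ψ v).IsHomogeneous (w v)) :
    (aeval ψ P).IsHomogeneous n := by
  classical
  rw [P.as_sum, map_sum]
  refine IsHomogeneous.sum _ _ _ fun γ hγ => ?_
  rw [aeval_monomial, MvPolynomial.algebraMap_apply, Finsupp.prod]
  have hw : Finsupp.weight w γ = n := hP (mem_support_iff.mp hγ)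
  have hprod : (∏ v ∈ γ.support, ψ v ^ γ v).IsHomogeneous (∑ v ∈ γ.support, w v * γ v) :=
    IsHomogeneous.prod _ _ _ fun v _ => (hψ v).pow (γ v)
  have hsum : ∑ v ∈ γ.support, w v * γ v = n := by
    rw [← hw, Finsupp.weight_apply, Finsupp.sum]
    exact Finset.sum_congr rfl fun v _ => by rw [smul_eq_mul, mul_comm]
  rw [hsum] at hprod
  exact hprod.C_mul _

/-- A form of degree `d` in finitely many variables has at most `(#vars)^d` monomials.
[folklore] -/
theorem card_support_le_card_pow_of_isHomogeneous {σ : Type*} [Fintype σ] {P : MvPolynomial σ ℂ}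
    {d : ℕ} (hP : P.IsHomogeneous d) : P.support.card ≤ Fintype.card σ ^ d := by
  classical
  set e := Fintype.equivFin σ
  have h1 : (rename e P).support.card = P.support.card := by
    rw [support_rename_of_injective e.injective,
      Finset.card_image_of_injective _ (Finsupp.mapDomain_injective e.injective)]
  rw [← h1]
  exact card_support_le_pow_of_isHomogeneous (hP.rename_isHomogeneous (f := e))

/-- The numerical constant of the block step is at most `e^{4m³}`:
`(m+1)² · e^{n} · (#vars T)^r ≤ e^{4m³}` for `1 ≤ r ≤ m`, `n = m(m+1)/2`,
`#vars T = r n + r(m+1)`. [folklore] -/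
theorem blockConst_le_exp {r : ℕ} (hr1 : 1 ≤ r) (hrm : r ≤ m) :
    ((m : ℝ) + 1) ^ 2 * Real.exp (Fintype.card (Fin 1 × SkewIdx m)) *
        (Fintype.card ((Fin r × SkewIdx m) ⊕ (Fin r × Fin (m + 1))) : ℝ) ^ r ≤
      Real.exp (4 * (m : ℝ) ^ 3) := by
  have hskew : 2 * Fintype.card (SkewIdx m) = m * (m + 1) := two_mul_card_skewIdx m
  have hcard1 : Fintype.card (Fin 1 × SkewIdx m) = Fintype.card (SkewIdx m) := by simp
  have hcardT : Fintype.card ((Fin r × SkewIdx m) ⊕ (Fin r × Fin (m + 1))) =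
      r * Fintype.card (SkewIdx m) + r * (m + 1) := by simp
  set n := Fintype.card (SkewIdx m) with hn
  rw [hcard1, hcardT]
  rcases Nat.lt_or_ge m 2 with hm | hm
  · -- `m = 1`, `r = 1`, `n = 1`, `#vars = 3`: `4 · e · 3 ≤ e⁴` since `12 ≤ e³`
    have hm1 : m = 1 := by omega
    have hr : r = 1 := by omega
    subst hm1; subst hr
    have hn1 : n = 1 := by omega
    rw [hn1]
    norm_num
    have he : (2.7182818283 : ℝ) < Real.exp 1 := Real.exp_one_gt_d9
    have h3 : (12 : ℝ) ≤ Real.exp 3 := by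
      have : Real.exp 3 = Real.exp 1 ^ 3 := by rw [← Real.exp_nat_mul]; norm_num
      rw [this]
      calc (12 : ℝ) ≤ 2.7182818283 ^ 3 := by norm_num
        _ ≤ Real.exp 1 ^ 3 := pow_le_pow_left₀ (by norm_num) he.le 3
    calc (4 : ℝ) * Real.exp 1 * 3 = 12 * Real.exp 1 := by ring
      _ ≤ Real.exp 3 * Real.exp 1 := mul_le_mul_of_nonneg_right h3 (Real.exp_pos 1).le
      _ = Real.exp 4 := by rw [← Real.exp_add]; norm_num
  · -- `m ≥ 2`: `(m+1)² ≤ e^{2m}`, `#vars ≤ (m+1)³ ≤ e^{3m}`, `2m + n + 3m² ≤ 4m³`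
    have hmR : (2 : ℝ) ≤ m := by exact_mod_cast hm
    have h1 : ((m : ℝ) + 1) ≤ Real.exp m := by
      have := Real.add_one_le_exp (m : ℝ); linarith
    have h1' : ((m : ℝ) + 1) ^ 2 ≤ Real.exp (2 * m) := by
      calc ((m : ℝ) + 1) ^ 2 ≤ Real.exp m ^ 2 := pow_le_pow_left₀ (by positivity) h1 2
        _ = Real.exp (2 * m) := by rw [← Real.exp_nat_mul]; norm_num
    have hT : ((r * n + r * (m + 1) : ℕ) : ℝ) ≤ ((m : ℝ) + 1) ^ 3 := by
      have h2 : r * n + r * (m + 1) ≤ m * n + m * (m + 1) :=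
        add_le_add (Nat.mul_le_mul_right _ hrm) (Nat.mul_le_mul_right _ hrm)
      have h3 : 2 * (m * n + m * (m + 1)) ≤ 2 * (m + 1) ^ 3 := by
        have e1 : 2 * (m * n + m * (m + 1)) = m * (2 * n) + 2 * m * (m + 1) := by ring
        rw [hskew] at e1
        rw [e1]
        nlinarith
      have h4 : r * n + r * (m + 1) ≤ (m + 1) ^ 3 := by omega
      exact_mod_cast h4
    have hT' : ((r * n + r * (m + 1) : ℕ) : ℝ) ^ r ≤ Real.exp (3 * (m : ℝ) ^ 2) := by
      calc ((r * n + r * (m + 1) : ℕ) : ℝ) ^ r ≤ (((m : ℝ) + 1) ^ 3) ^ r :=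
            pow_le_pow_left₀ (by positivity) hT r
        _ ≤ (Real.exp m ^ 3) ^ r := by gcongr
        _ = Real.exp (3 * m * r) := by
            rw [← Real.exp_nat_mul, ← Real.exp_nat_mul]; congr 1; push_cast; ring
        _ ≤ Real.exp (3 * (m : ℝ) ^ 2) := by
            refine Real.exp_le_exp.mpr ?_
            have : (r : ℝ) ≤ m := by exact_mod_cast hrm
            nlinarith
    have hn' : (n : ℝ) ≤ (m : ℝ) ^ 2 := by
      have : 2 * (n : ℝ) = m * (m + 1) := by exact_mod_cast hskew
      nlinarith
    calc ((m : ℝ) + 1) ^ 2 * Real.exp n * ((r * n + r * (m + 1) : ℕ) : ℝ) ^ r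
        ≤ Real.exp (2 * m) * Real.exp ((m : ℝ) ^ 2) * Real.exp (3 * (m : ℝ) ^ 2) := by
          gcongr
      _ = Real.exp (2 * m + 4 * (m : ℝ) ^ 2) := by rw [← Real.exp_add, ← Real.exp_add]; ring_nf
      _ ≤ Real.exp (4 * (m : ℝ) ^ 3) := Real.exp_le_exp.mpr (by nlinarith)

/-! ### The block step -/

/-- **The block step** (see the module docstring). Here `F = chowForm I r`, `N = ideg I r ≥ 1`,
`Ī(r)` is principal, `ω̄ ≠ 0`, `k < r`, and `Φ_k` is written out: `u_{ij} ↦ (S⁽ⁱ⁾ω̄)_j` (in the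
skew variables of block `i`) for `i < k`, `u_{ij} ↦ u_{ij}` otherwise.
[cite: NesterenkoPhilippon2001, Ch. 3 Prop. 4.13 (p. 41)] -/
theorem block_step {r : ℕ} {I : Ideal (Rx m)} (hr : 0 < r)
    (hIh : letI := MvPolynomial.gradedAlgebra (σ := Fin (m + 1)) (R := ℚ)
      I.IsHomogeneous (homogeneousSubmodule (Fin (m + 1)) ℚ))
    (hpr : (elimIdeal I r).IsPrincipal) (hN : 1 ≤ ideg I r)
    {ω : Fin (m + 1) → ℂ} (hω : ω ≠ 0) {k : ℕ} (hk : k < r)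
    (hFk : aeval (fun v : Fin r × Fin (m + 1) =>
        if (v.1 : ℕ) < k then rename Sum.inl (lam ω v.1 v.2)
        else (X (Sum.inr v) : MvPolynomial ((Fin r × SkewIdx m) ⊕ (Fin r × Fin (m + 1))) ℂ))
      (chowForm I r) ≠ 0) :
    ∃ β ∈ projZeros I, projDist ω β = 0 ∨
      (projDist ω β * ‖ω‖) ^ ideg I r *
        maxNorm (aeval (fun v : Fin r × Fin (m + 1) =>
          if (v.1 : ℕ) < k then rename Sum.inl (lam ω v.1 v.2)
          else (X (Sum.inr v) : MvPolynomial ((Fin r × SkewIdx m) ⊕ (Fin r × Fin (m + 1))) ℂ))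
            (chowForm I r)) ≤
      ((m : ℝ) + 1) ^ ideg I r * (Real.exp (Fintype.card (Fin 1 × SkewIdx m) * ideg I r) *
        ((m : ℝ) + 1) ^ ideg I r *
        ((Fintype.card ((Fin r × SkewIdx m) ⊕ (Fin r × Fin (m + 1))) : ℝ) ^ (r * ideg I r) *
        maxNorm (aeval (fun v : Fin r × Fin (m + 1) =>
          if (v.1 : ℕ) < k + 1 then rename Sum.inl (lam ω v.1 v.2)
          else (X (Sum.inr v) : MvPolynomial ((Fin r × SkewIdx m) ⊕ (Fin r × Fin (m + 1))) ℂ))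
            (chowForm I r)))) := by
  classical
  set F := chowForm I r with hFdef
  set N := ideg I r with hNdef
  set kk : Fin r := ⟨k, hk⟩ with hkk
  -- the two specialisations
  set φk : Fin r × Fin (m + 1) → MvPolynomial ((Fin r × SkewIdx m) ⊕ (Fin r × Fin (m + 1))) ℂ :=
    fun v => if (v.1 : ℕ) < k then rename Sum.inl (lam ω v.1 v.2) else X (Sum.inr v) with hφk
  set φk1 : Fin r × Fin (m + 1) → MvPolynomial ((Fin r × SkewIdx m) ⊕ (Fin r × Fin (m + 1))) ℂ :=
    fun v => if (v.1 : ℕ) < k + 1 then rename Sum.inl (lam ω v.1 v.2) else X (Sum.inr v) with hφk1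
  set Fk := aeval φk F with hFkdef
  set Fk1 := aeval φk1 F with hFk1def
  change Fk ≠ 0 at hFk
  -- a point of the torus where `|F_k(v₀)| ≥ |F_k|`
  obtain ⟨v₀, hv₀1, hv₀⟩ := exists_eval_ge_maxNorm Fk
  -- the frozen rows and the form `g`
  set rows : Fin r → Fin (m + 1) → ℂ := fun i j =>
    if (i : ℕ) < k then eval v₀ (rename Sum.inl (lam ω i j)) else v₀ (Sum.inr (i, j)) with hrows
  set ψ : Fin r × Fin (m + 1) → MvPolynomial (Fin (m + 1)) ℂ :=
    fun v => if v.1 = kk then X v.2 else C (rows v.1 v.2) with hψ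
  set g := aeval ψ F with hgdef
  -- evaluation of `g`
  have heval : ∀ u : Fin (m + 1) → ℂ, eval u g =
      aeval (fun v : Fin r × Fin (m + 1) => if v.1 = kk then u v.2 else rows v.1 v.2) F := by
    intro u
    have h := congrArg (fun φ : RU r m →ₐ[ℚ] ℂ => φ F)
      (comp_aeval (R := ℚ) (f := ψ) ((aeval u).restrictScalars ℚ))
    simp only [AlgHom.comp_apply, AlgHom.restrictScalars_apply, MvPolynomial.aeval_eq_eval] at h
    rw [hgdef, h]
    refine congrArg (fun f => aeval f F) (funext fun v => ?_)
    simp only [hψ]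
    split_ifs <;> simp
  -- `g(v₀|_k) = F_k(v₀)`
  have hgv : eval (fun j => v₀ (Sum.inr (kk, j))) g = eval v₀ Fk := by
    rw [heval]
    have h := congrArg (fun φ : RU r m →ₐ[ℚ] ℂ => φ F)
      (comp_aeval (R := ℚ) (f := φk) ((aeval v₀).restrictScalars ℚ))
    simp only [AlgHom.comp_apply, AlgHom.restrictScalars_apply, MvPolynomial.aeval_eq_eval] at h
    rw [hFkdef, h]
    refine congrArg (fun f => aeval f F) (funext fun v => ?_)
    obtain ⟨i, j⟩ := v
    simp only [hφk, hrows]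
    by_cases hv : i = kk
    · subst hv
      have hvk : ¬ ((kk : ℕ) < k) := lt_irrefl _
      rw [if_pos rfl, if_neg hvk, eval_X]
    · rw [if_neg hv]
      split_ifs with h1
      · rfl
      · rw [eval_X]
  -- hence `|F_k| ≤ #supp g · |g|`, and `g ≠ 0`
  have hFk_le : maxNorm Fk ≤ g.support.card * maxNorm g := by
    calc maxNorm Fk ≤ ‖eval v₀ Fk‖ := hv₀
      _ = ‖eval (fun j => v₀ (Sum.inr (kk, j))) g‖ := by rw [hgv]
      _ ≤ g.support.card * maxNorm g :=
          norm_eval_le_card_mul_maxNorm g fun j => (hv₀1 _).le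
  have hg0 : g ≠ 0 := by
    intro h
    rw [h, support_zero, Finset.card_empty, Nat.cast_zero, zero_mul] at hFk_le
    exact absurd (le_antisymm hFk_le (maxNorm_nonneg _)) (maxNorm_pos hFk).ne'
  -- `g` is a form of degree `N`
  have hghom : g.IsHomogeneous N := by
    refine isHomogeneous_aeval_of_isWeightedHomogeneous (chowForm_isWeightedHomogeneous I hr kk) ψ
      fun v => ?_
    simp only [hψ]
    split_ifs with h
    · exact isHomogeneous_X _ _
    · exact isHomogeneous_C _ _
  have hgdeg : g.totalDegree = N := hghom.totalDegree hg0
  have hgsupp : (g.support.card : ℝ) ≤ ((m : ℝ) + 1) ^ N := by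
    have := card_support_le_pow_of_isHomogeneous hghom
    exact_mod_cast this
  -- zeros of `g`: the set `V'` of zeros of `I` on the frozen hyperplanes
  set V' : Set (Fin (m + 1) → ℂ) :=
    {β | β ∈ projZeros I ∧ ∀ i : Fin r, i ≠ kk → ∑ j, rows i j * β j = 0} with hV'
  have hV0 : ∀ β ∈ V', β ≠ 0 := fun β hβ => hβ.1.1
  have hiff : ∀ u : Fin (m + 1) → ℂ, eval u g = 0 ↔ ∃ β ∈ V', ∑ j, β j * u j = 0 := by
    intro u
    rw [heval, aeval_chowForm_eq_zero_iff hIh hpr]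
    have hcomm : ∀ β : Fin (m + 1) → ℂ, ∑ j, β j * u j = ∑ j, u j * β j :=
      fun β => Finset.sum_congr rfl fun j _ => mul_comm _ _
    constructor
    · rintro ⟨β, hβV, hβ⟩
      refine ⟨β, ⟨hβV, fun i hi => ?_⟩, ?_⟩
      · simpa [hi] using hβ i
      · rw [hcomm]; simpa using hβ kk
    · rintro ⟨β, ⟨hβV, hβrows⟩, hβu⟩
      refine ⟨β, hβV, fun i => ?_⟩
      by_cases hi : i = kk
      · subst hi
        rw [hcomm] at hβu
        simpa using hβu
      · simpa [hi] using hβrows i hi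
  -- the one-block estimate
  have hNpos : 0 < g.totalDegree := by rw [hgdeg]; exact hN
  obtain ⟨h_i, h_ii⟩ := one_block hg0 hNpos hV0 hiff hω
  -- `Λ`: specialise `F_{k+1}` at `v₀` in all variables but the block-`k` skew ones
  set Λf : (Fin r × SkewIdx m) ⊕ (Fin r × Fin (m + 1)) → RS 1 m :=
    Sum.elim (fun iq => if iq.1 = kk then X ((0 : Fin 1), iq.2) else C (v₀ (Sum.inl iq)))
      (fun v => C (v₀ (Sum.inr v))) with hΛf
  set Λ : MvPolynomial ((Fin r × SkewIdx m) ⊕ (Fin r × Fin (m + 1))) ℂ →ₐ[ℂ] RS 1 m :=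
    aeval Λf with hΛ
  have hΛskew_k : ∀ j l, aeval (fun iq : Fin r × SkewIdx m => Λf (Sum.inl iq)) (skewEntry kk j l) =
      (skewEntry (0 : Fin 1) j l : RS 1 m) := by
    intro j l
    unfold skewEntry
    split_ifs <;> simp [hΛf]
  have hΛskew_ne : ∀ i, i ≠ kk → ∀ j l,
      aeval (fun iq : Fin r × SkewIdx m => Λf (Sum.inl iq)) (skewEntry i j l) =
        C (eval (fun iq : Fin r × SkewIdx m => v₀ (Sum.inl iq)) (skewEntry i j l)) := by
    intro i hi j l
    unfold skewEntry
    split_ifs <;> simp [hΛf, hi]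
  have hΛFk1 : Λ Fk1 = aeval (fun j => lam ω (0 : Fin 1) j) g := by
    -- both sides are `aeval` of `F` for the same substitution
    have hL := congrArg (fun φ : RU r m →ₐ[ℚ] RS 1 m => φ F)
      (comp_aeval (R := ℚ) (f := φk1) (Λ.restrictScalars ℚ))
    have hR := congrArg (fun φ : RU r m →ₐ[ℚ] RS 1 m => φ F)
      (comp_aeval (R := ℚ) (f := ψ) ((aeval (fun j => lam ω (0 : Fin 1) j)).restrictScalars ℚ))
    simp only [AlgHom.comp_apply, AlgHom.restrictScalars_apply] at hL hR
    rw [hFk1def, hgdef, hL, hR]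
    refine congrArg (fun f => aeval f F) (funext fun v => ?_)
    obtain ⟨i, j⟩ := v
    simp only [hφk1, hψ]
    by_cases hik : i = kk
    · -- block `k`: `Λ (S⁽ᵏ⁾ω̄)_j = (S ω̄)_j` and `κ (x_j) = (S ω̄)_j`
      subst hik
      have hlt : ((kk : Fin r) : ℕ) < k + 1 := Nat.lt_succ_self _
      rw [if_pos hlt, if_pos rfl, aeval_X, hΛ, aeval_rename]
      simp only [lam, map_sum, map_mul, aeval_C, MvPolynomial.algebraMap_eq, Function.comp_def]
      refine Finset.sum_congr rfl fun l _ => ?_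
      rw [hΛskew_k]
    · rw [if_neg hik, aeval_C, MvPolynomial.algebraMap_eq]
      by_cases hlt : (i : ℕ) < k + 1
      · have hlt' : (i : ℕ) < k := by
          rcases Nat.lt_succ_iff_lt_or_eq.mp hlt with h | h
          · exact h
          · exact absurd (Fin.ext h) hik
        rw [if_pos hlt, hΛ, aeval_rename, hrows]
        simp only [if_pos hlt', eval_rename]
        simp only [lam, map_sum, map_mul, aeval_C, eval_C, MvPolynomial.algebraMap_eq,
          Function.comp_def]
        refine Finset.sum_congr rfl fun l _ => ?_
        rw [hΛskew_ne i hik]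
      · have hlt' : ¬ (i : ℕ) < k := fun h => hlt (Nat.lt_succ_of_lt h)
        rw [if_neg hlt, hΛ, aeval_X, hΛf, Sum.elim_inr, hrows]
        simp only [if_neg hlt']
  -- `|Λ F_{k+1}| ≤ #supp F_{k+1} · |F_{k+1}|`
  have hΛle : maxNorm (Λ Fk1) ≤ Fk1.support.card * maxNorm Fk1 := by
    refine maxNorm_aeval_le_card_mul Λf (fun p => ?_) Fk1
    rcases p with iq | v
    · simp only [hΛf, Sum.elim_inl]
      split_ifs
      · rw [l1Norm_X]
      · rw [l1Norm_C, hv₀1]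
    · simp only [hΛf, Sum.elim_inr]
      rw [l1Norm_C, hv₀1]
  -- `F_{k+1}` is a form of degree `rN`, so `#supp F_{k+1} ≤ (#vars)^{rN}`
  have hFhom : F.IsHomogeneous (r * N) := fun γ hγ => by
    have h := degree_eq_of_mem_support_chowForm I hr (mem_support_iff.mpr hγ)
    rw [Finsupp.degree_eq_weight_one] at h
    exact h
  have hφk1hom : ∀ v, (φk1 v).IsHomogeneous 1 := by
    intro v
    simp only [hφk1]
    split_ifs
    · refine IsHomogeneous.rename_isHomogeneous ?_
      unfold lam
      refine IsHomogeneous.sum _ _ _ fun l _ => ?_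
      have h1 : (skewEntry v.1 v.2 l : RS r m).IsHomogeneous 1 := by
        unfold skewEntry
        split_ifs
        · exact isHomogeneous_X _ _
        · exact (isHomogeneous_X _ _).neg
        · exact isHomogeneous_zero _ _ _
      simpa using h1.mul (isHomogeneous_C _ (ω l))
    · exact isHomogeneous_X _ _
  have hFk1hom : Fk1.IsHomogeneous (r * N) := by
    have h := hFhom.aeval φk1 hφk1hom
    rwa [one_mul] at h
  have hFk1supp : (Fk1.support.card : ℝ) ≤
      ((Fintype.card ((Fin r × SkewIdx m) ⊕ (Fin r × Fin (m + 1)))) : ℝ) ^ (r * N) := by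
    have := card_support_le_card_pow_of_isHomogeneous hFk1hom
    exact_mod_cast this
  -- conclude
  by_cases hκ : aeval (fun j => lam ω (0 : Fin 1) j) g = 0
  · obtain ⟨β, hβV', hβ0⟩ := h_i hκ
    exact ⟨β, hβV'.1, Or.inl hβ0⟩
  · obtain ⟨β, hβV', hβ⟩ := h_ii hκ
    refine ⟨β, hβV'.1, Or.inr ?_⟩
    rw [hgdeg] at hβ
    have hδ0 : 0 ≤ (projDist ω β * ‖ω‖) ^ N :=
      pow_nonneg (mul_nonneg (projDist_nonneg _ _) (norm_nonneg _)) N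
    have hm1 : 0 ≤ ((m : ℝ) + 1) ^ N := by positivity
    have hE0 : 0 ≤ Real.exp (Fintype.card (Fin 1 × SkewIdx m) * N) * ((m : ℝ) + 1) ^ N := by
      positivity
    calc (projDist ω β * ‖ω‖) ^ N * maxNorm Fk
        ≤ (projDist ω β * ‖ω‖) ^ N * (g.support.card * maxNorm g) :=
          mul_le_mul_of_nonneg_left hFk_le hδ0
      _ ≤ (projDist ω β * ‖ω‖) ^ N * (((m : ℝ) + 1) ^ N * maxNorm g) :=
          mul_le_mul_of_nonneg_left (mul_le_mul_of_nonneg_right hgsupp (maxNorm_nonneg g)) hδ0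
      _ = ((m : ℝ) + 1) ^ N * ((projDist ω β * ‖ω‖) ^ N * maxNorm g) := by ring
      _ ≤ ((m : ℝ) + 1) ^ N * (Real.exp (Fintype.card (Fin 1 × SkewIdx m) * N) *
            ((m : ℝ) + 1) ^ N * maxNorm (aeval (fun j => lam ω (0 : Fin 1) j) g)) :=
          mul_le_mul_of_nonneg_left hβ hm1
      _ = ((m : ℝ) + 1) ^ N * (Real.exp (Fintype.card (Fin 1 × SkewIdx m) * N) *
            ((m : ℝ) + 1) ^ N * maxNorm (Λ Fk1)) := by rw [hΛFk1]
      _ ≤ ((m : ℝ) + 1) ^ N * (Real.exp (Fintype.card (Fin 1 × SkewIdx m) * N) *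
            ((m : ℝ) + 1) ^ N * (Fk1.support.card * maxNorm Fk1)) :=
          mul_le_mul_of_nonneg_left (mul_le_mul_of_nonneg_left hΛle hE0) hm1
      _ ≤ ((m : ℝ) + 1) ^ N * (Real.exp (Fintype.card (Fin 1 × SkewIdx m) * N) *
            ((m : ℝ) + 1) ^ N *
            (((Fintype.card ((Fin r × SkewIdx m) ⊕ (Fin r × Fin (m + 1)))) : ℝ) ^ (r * N) *
              maxNorm Fk1)) :=
          mul_le_mul_of_nonneg_left (mul_le_mul_of_nonneg_left
            (mul_le_mul_of_nonneg_right hFk1supp (maxNorm_nonneg _)) hE0) hm1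
      _ = _ := by ring



/-- An irreducible associated form has block degree `≥ 1` (it is not a constant).
[cite: NesterenkoPhilippon2001, Ch. 3 Prop. 4.4 (p. 38)] -/
theorem one_le_ideg_of_irreducible_chowForm {r : ℕ} (hr : 0 < r) {J : Ideal (Rx m)}
    (hirr : Irreducible (chowForm J r)) : 1 ≤ ideg J r := by
  classical
  set G := chowForm J r with hGdef
  have hG0 : G ≠ 0 := hirr.ne_zero
  obtain ⟨e, he, hene⟩ : ∃ e ∈ G.support, e ≠ 0 := by
    by_contra h
    push Not at h
    have hGC : G = C (G.coeff 0) := by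
      ext e
      by_cases he0 : e = 0
      · subst he0; simp
      · rw [coeff_C, if_neg (Ne.symm he0)]
        by_contra hc
        exact he0 (h e (mem_support_iff.mpr hc))
    have hc0 : G.coeff 0 ≠ 0 := fun hc => hG0 (by rw [hGC, hc, C_0])
    exact hirr.not_isUnit (by rw [hGC]; exact (IsUnit.mk0 _ hc0).map C)
  obtain ⟨⟨i, j⟩, hij⟩ : ∃ ij, e ij ≠ 0 := by
    by_contra h
    push Not at h
    exact hene (Finsupp.ext h)
  have h1 : 1 ≤ bdeg i e :=
    (Nat.one_le_iff_ne_zero.mpr hij).trans (Finset.single_le_sum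
      (f := fun j' : Fin (m + 1) => e (i, j')) (fun _ _ => Nat.zero_le _) (Finset.mem_univ j))
  rw [← bdeg_eq_ideg_of_mem_support_chowForm J hr he i]
  exact h1

/-- **LNM 1752 Ch. 3 Proposition 4.13 from Proposition 4.4** (see the module docstring).
[cite: NesterenkoPhilippon2001, Ch. 3 Prop. 4.13 (p. 41)] -/
theorem NesterenkoPhilippon2001_ch3_prop_4_13_of_prop_4_4
    (h44 : NesterenkoPhilippon2001_ch3_prop_4_4) : NesterenkoPhilippon2001_ch3_prop_4_13 := by
  intro m r I hr1 hrm hIh hI ω hω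
  classical
  have hr : 0 < r := hr1
  -- Proposition 4.4: `Ī(r) = (F)` principal, `F = c ∏ F_Q^{k_Q}`, `F_Q` irreducible
  obtain ⟨t, ht⟩ : ∃ t : Finset (Ideal (Rx m)), Submodule.IsMinimalPrimaryDecomposition I t :=
    Submodule.IsLasker.exists_isMinimalPrimaryDecomposition (Submodule.isLasker (Rx m) (Rx m)) I
  obtain ⟨hpr, hPQ, hFprop, -⟩ := h44 m r I hr1 hrm hIh hI t ht
  obtain ⟨hFQ0, c0, hc0, hprod⟩ := exists_chowForm_eq_C_mul_prod h44 hr1 hrm hIh hI ht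
  set F := chowForm I r with hFdef
  set N := ideg I r with hNdef
  -- `N ≥ 1`
  have htne : t.Nonempty := by
    rw [Finset.nonempty_iff_ne_empty]
    rintro rfl
    apply hI.1
    have := ht.inf_eq
    simpa using this.symm
  obtain ⟨Q₀, hQ₀⟩ := htne
  have hirr : Irreducible (chowForm Q₀.radical r) :=
    (hFprop (fun Q => chowForm Q.radical r) (fun Q hQ => span_chowForm _ _ (hPQ Q hQ))).1 Q₀ hQ₀
  have hN : 1 ≤ N := by
    have hsum := sum_primaryExponent_mul_ideg_eq h44 hr1 hrm hIh hI ht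
    have h1 : 1 ≤ primaryExponent Q₀ * ideg Q₀.radical r :=
      Nat.one_le_iff_ne_zero.mpr (Nat.mul_ne_zero
        (primaryExponent_pos (ht.primary hQ₀).ne_top).ne'
        (Nat.one_le_iff_ne_zero.mp (one_le_ideg_of_irreducible_chowForm hr hirr)))
    calc 1 ≤ primaryExponent Q₀ * ideg Q₀.radical r := h1
      _ ≤ ∑ Q ∈ t, primaryExponent Q * ideg Q.radical r :=
          Finset.single_le_sum (f := fun Q => primaryExponent Q * ideg Q.radical r)
            (fun _ _ => Nat.zero_le _) hQ₀
      _ = N := hsum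
  have hF0 : F ≠ 0 :=
    ne_of_eq_of_ne hprod (mul_ne_zero (by rwa [Ne, C_eq_zero])
      (Finset.prod_ne_zero_iff.mpr fun Q hQ => pow_ne_zero _ (hFQ0 Q hQ)))
  -- the specialisations `F_k`
  set Fk : ℕ → MvPolynomial ((Fin r × SkewIdx m) ⊕ (Fin r × Fin (m + 1))) ℂ := fun k =>
    aeval (fun v : Fin r × Fin (m + 1) =>
      if (v.1 : ℕ) < k then rename Sum.inl (lam ω v.1 v.2)
      else (X (Sum.inr v) : MvPolynomial ((Fin r × SkewIdx m) ⊕ (Fin r × Fin (m + 1))) ℂ)) F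
    with hFk
  -- `F_0 = F`, `F_r = ϰ(F)`
  have hF0eq : Fk 0 = rename Sum.inr (map (algebraMap ℚ ℂ) F) := by
    show aeval _ F = _
    generalize F = G
    induction G using MvPolynomial.induction_on with
    | C a =>
      rw [aeval_C, map_C, rename_C]
      simp [MvPolynomial.algebraMap_apply]
    | add p q hp hq => rw [map_add, map_add, map_add, hp, hq]
    | mul_X p v hp =>
      rw [map_mul, map_mul, map_mul, hp, map_X, rename_X]
      simp only [aeval_X, Nat.not_lt_zero, if_false]
  have hFreq : Fk r = rename Sum.inl (kappa ω F) := by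
    show aeval _ F = _
    rw [kappa_eq_aeval_lam]
    generalize F = G
    induction G using MvPolynomial.induction_on with
    | C a =>
      rw [aeval_C, aeval_C]
      simp only [MvPolynomial.algebraMap_apply, rename_C]
    | add p q hp hq => rw [map_add, map_add, map_add, hp, hq]
    | mul_X p v hp =>
      rw [map_mul, map_mul, map_mul, hp]
      simp only [aeval_X, if_pos v.1.2]
  have hnorm0 : maxNorm (Fk 0) = maxNorm F := by
    rw [hF0eq, maxNorm_rename_of_injective Sum.inr_injective, maxNorm_map_algebraMap]
  have hnormr : maxNorm (Fk r) = maxNorm (kappa ω F) := by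
    rw [hFreq, maxNorm_rename_of_injective Sum.inl_injective]
  have hFk0 : Fk 0 ≠ 0 := by
    intro h
    have := maxNorm_pos hF0
    rw [← hnorm0, h, maxNorm_zero] at this
    exact lt_irrefl _ this
  have hωpos : 0 < ‖ω‖ := norm_pos_iff.mpr hω
  have hiabs : iabs I r ω = maxNorm (Fk r) / maxNorm (Fk 0) / ‖ω‖ ^ (r * N) := by
    rw [hnormr, hnorm0, div_div]
    rfl
  have hiabs0 : 0 ≤ iabs I r ω := iabs_nonneg _ _ _
  -- the constant
  set Cst : ℝ := ((m : ℝ) + 1) ^ 2 * Real.exp (Fintype.card (Fin 1 × SkewIdx m)) *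
    (Fintype.card ((Fin r × SkewIdx m) ⊕ (Fin r × Fin (m + 1))) : ℝ) ^ r with hCst
  have hCst0 : 0 ≤ Cst := by positivity
  have hCst_le : Cst ≤ Real.exp (4 * (m : ℝ) ^ 3) := blockConst_le_exp hr1 hrm
  have hBIG : ((m : ℝ) + 1) ^ N * (Real.exp (Fintype.card (Fin 1 × SkewIdx m) * N) *
      ((m : ℝ) + 1) ^ N *
      (Fintype.card ((Fin r × SkewIdx m) ⊕ (Fin r × Fin (m + 1))) : ℝ) ^ (r * N)) = Cst ^ N := by
    rw [hCst, mul_pow, mul_pow, ← Real.exp_nat_mul, ← pow_mul]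
    ring_nf
  -- MAIN: a zero `β` with `‖ω − β‖ = 0` or `(‖ω − β‖ |ω|)^N ≤ Cst^N (|F_r|/|F_0|)^{1/r}`
  have hmain : ∃ β ∈ projZeros I, projDist ω β = 0 ∨
      (projDist ω β * ‖ω‖) ^ N ≤ Cst ^ N * (maxNorm (Fk r) / maxNorm (Fk 0)) ^ (1 / (r : ℝ)) := by
    by_cases hall : ∀ k ≤ r, Fk k ≠ 0
    · -- pigeonhole
      obtain ⟨k, hk, hle⟩ := exists_succ_le_rpow_mul hr (fun k => maxNorm (Fk k))
        fun k hk => maxNorm_pos (hall k hk)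
      obtain ⟨β, hβV, hβ⟩ := block_step hr hIh hpr hN hω hk (hall k hk.le)
      rcases hβ with h0 | hineq
      · exact ⟨β, hβV, Or.inl h0⟩
      refine ⟨β, hβV, Or.inr ?_⟩
      have hineq' : (projDist ω β * ‖ω‖) ^ N * maxNorm (Fk k) ≤ Cst ^ N * maxNorm (Fk (k + 1)) :=
        calc (projDist ω β * ‖ω‖) ^ N * maxNorm (Fk k) ≤ _ := hineq
          _ = Cst ^ N * maxNorm (Fk (k + 1)) := by rw [← hBIG]; ring
      have hpos : 0 < maxNorm (Fk k) := maxNorm_pos (hall k hk.le)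
      have h2 : (projDist ω β * ‖ω‖) ^ N * maxNorm (Fk k) ≤
          Cst ^ N * (maxNorm (Fk r) / maxNorm (Fk 0)) ^ (1 / (r : ℝ)) * maxNorm (Fk k) := by
        calc (projDist ω β * ‖ω‖) ^ N * maxNorm (Fk k) ≤ Cst ^ N * maxNorm (Fk (k + 1)) := hineq'
          _ ≤ Cst ^ N * ((maxNorm (Fk r) / maxNorm (Fk 0)) ^ (1 / (r : ℝ)) * maxNorm (Fk k)) :=
              mul_le_mul_of_nonneg_left hle (pow_nonneg hCst0 N)
          _ = _ := by ring
      exact le_of_mul_le_mul_right h2 hpos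
    · -- some `F_k = 0`: take the first one
      push Not at hall
      have hex : ∃ k, k ≤ r ∧ Fk k = 0 := by
        obtain ⟨k, hk, h⟩ := hall; exact ⟨k, hk, h⟩
      set k₁ := Nat.find hex with hk₁
      obtain ⟨hk₁r, hk₁0⟩ := Nat.find_spec hex
      have hk₁ne : k₁ ≠ 0 := by
        intro h
        rw [← hk₁, h] at hk₁0
        exact hFk0 hk₁0
      set k := k₁ - 1 with hkdef
      have hk1 : k + 1 = k₁ := by omega
      have hk : k < r := by omega
      have hFkne : Fk k ≠ 0 := by
        intro h
        have := Nat.find_min hex (show k < k₁ by omega)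
        exact this ⟨by omega, h⟩
      obtain ⟨β, hβV, hβ⟩ := block_step hr hIh hpr hN hω hk hFkne
      rcases hβ with h0 | hineq
      · exact ⟨β, hβV, Or.inl h0⟩
      refine ⟨β, hβV, Or.inl ?_⟩
      have hzero : Fk (k + 1) = 0 := by rw [hk1, hk₁]; exact hk₁0
      have hm0 : maxNorm (Fk (k + 1)) = 0 := by rw [hzero, maxNorm_zero]
      have hineq' : (projDist ω β * ‖ω‖) ^ N * maxNorm (Fk k) ≤ 0 :=
        calc (projDist ω β * ‖ω‖) ^ N * maxNorm (Fk k) ≤ _ := hineq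
          _ = Cst ^ N * maxNorm (Fk (k + 1)) := by rw [← hBIG]; ring
          _ = 0 := by rw [hm0, mul_zero]
      have hpos : 0 < maxNorm (Fk k) := maxNorm_pos hFkne
      have h3 : (projDist ω β * ‖ω‖) ^ N ≤ 0 :=
        le_of_mul_le_mul_right (by rw [zero_mul]; exact hineq') hpos
      have h4 : (projDist ω β * ‖ω‖) ^ N = 0 :=
        le_antisymm h3 (pow_nonneg (mul_nonneg (projDist_nonneg _ _) (norm_nonneg _)) N)
      rw [pow_eq_zero_iff (by omega), mul_eq_zero] at h4
      rcases h4 with h4 | h4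
      · exact h4
      · exact absurd h4 hωpos.ne'
  -- CONCLUSION
  obtain ⟨β, hβV, hβ⟩ := hmain
  refine ⟨β, hβV, ?_⟩
  have hRHS0 : 0 ≤ (iabs I r ω * Real.exp (iheight I r)) ^ (1 / (r : ℝ)) *
      Real.exp (4 * (m : ℝ) ^ 3 * (ideg I r)) :=
    mul_nonneg (Real.rpow_nonneg (mul_nonneg hiabs0 (Real.exp_pos _).le) _) (Real.exp_pos _).le
  rcases hβ with h0 | hineq
  · rw [h0, zero_pow (by omega)]
    exact hRHS0
  -- `(|F_r|/|F_0|)^{1/r} = |I(ω)|^{1/r} |ω|^N`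
  have hratio : (maxNorm (Fk r) / maxNorm (Fk 0)) ^ (1 / (r : ℝ)) =
      iabs I r ω ^ (1 / (r : ℝ)) * ‖ω‖ ^ N := by
    have e1 : maxNorm (Fk r) / maxNorm (Fk 0) = iabs I r ω * (‖ω‖ ^ N) ^ r := by
      rw [hiabs, ← pow_mul, mul_comm N r, div_mul_cancel₀ _ (pow_ne_zero _ hωpos.ne')]
    rw [e1, Real.mul_rpow hiabs0 (by positivity), one_div,
      Real.pow_rpow_inv_natCast (by positivity) hr.ne']
  rw [hratio] at hineq
  -- cancel `|ω|^N`
  have hδ : projDist ω β ^ N ≤ Cst ^ N * iabs I r ω ^ (1 / (r : ℝ)) := by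
    have h1 : projDist ω β ^ N * ‖ω‖ ^ N ≤ Cst ^ N * iabs I r ω ^ (1 / (r : ℝ)) * ‖ω‖ ^ N := by
      rw [← mul_pow, mul_assoc]; exact hineq
    exact le_of_mul_le_mul_right h1 (pow_pos hωpos N)
  -- constants
  have hC : Cst ^ N ≤ Real.exp (4 * (m : ℝ) ^ 3 * N) := by
    calc Cst ^ N ≤ Real.exp (4 * (m : ℝ) ^ 3) ^ N := pow_le_pow_left₀ hCst0 hCst_le N
      _ = Real.exp (4 * (m : ℝ) ^ 3 * N) := by rw [← Real.exp_nat_mul]; ring_nf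
  have hh : iabs I r ω ^ (1 / (r : ℝ)) ≤ (iabs I r ω * Real.exp (iheight I r)) ^ (1 / (r : ℝ)) := by
    refine Real.rpow_le_rpow hiabs0 ?_ (by positivity)
    have : 1 ≤ Real.exp (iheight I r) := Real.one_le_exp (height_nonneg _)
    exact le_mul_of_one_le_right hiabs0 this
  calc projDist ω β ^ N ≤ Cst ^ N * iabs I r ω ^ (1 / (r : ℝ)) := hδ
    _ ≤ Real.exp (4 * (m : ℝ) ^ 3 * N) * (iabs I r ω * Real.exp (iheight I r)) ^ (1 / (r : ℝ)) :=
        mul_le_mul hC hh (Real.rpow_nonneg hiabs0 _) (Real.exp_pos _).le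
    _ = (iabs I r ω * Real.exp (iheight I r)) ^ (1 / (r : ℝ)) *
          Real.exp (4 * (m : ℝ) ^ 3 * (ideg I r)) := by rw [mul_comm]

end Nesterenko

end Literature.NumberTheory.Transcendental

end
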